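import Mathlib.NumberTheory.LSeries.Basic
import Mathlib.Analysis.SpecialFunctions.Integrals.Basic
import Mathlib.Analysis.Normed.Module.FiniteDimension
import Mathlib.MeasureTheory.Integral.Bochner.FundThmCalculus
import Mathlib.Analysis.Complex.ExponentialBounds
import HarnessLib

/-!
# An absolutely convergent Dirichlet series is large on every long interval

Topic `Literature/NumberTheory/LFunctions`. Everything here is PROVED (no named facts, no
definitions).

Let `L(s) = ∑ b(n) n^{−s}` be absolutely convergent on the line `re s = σ`. The mean value of
`t ↦ L(σ + it)` over a long interval is the constant term:
`(1/T) ∫_{T₀}^{T₀+T} L(σ + it) dt = b(1) + O((1/T) ∑_{n ≥ 2} |b(n)| n^{−σ}/log n)`, uniformly in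
`T₀` (H. Bohr; e.g. Titchmarsh, *The Theory of Functions*, §9.51, or Montgomery–Vaughan §1.? for
Dirichlet polynomials — the computation `∫ n^{−it} dt = n^{−it}/(−i log n)`). Consequently

* `exists_norm_LSeries_ge_on_long_interval` — for every `ε > 0` there is `T > 0` such that EVERY
  interval `[T₀, T₀ + T]` contains a `t` with `‖L(σ + it)‖ ≥ ‖b(1)‖ − ε`.

In particular an absolutely convergent Dirichlet series with `b(1) ≠ 0` does not tend to `0` along
`t → ∞`; this is the lower-bound input in growth arguments with functional equations (e.g. the
non-existence of elements of the Selberg class of degree `0 < d < 1`,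
`Literature/NumberTheory/LFunctions/SelbergClassDegreeProofs.lean`).

## References

* E. C. Titchmarsh, *The Theory of Functions*, 2nd ed. (1939), §9.51 (mean values of Dirichlet
  series). [folklore]
-/

noncomputable section

open Complex MeasureTheory Set Filter intervalIntegral Real

namespace Literature.NumberTheory.LFunctions

/-- The terms of `L(σ + it)`: `term b (σ + it) n = term b σ n · n^{−it}` (`n ≥ 1`) (a private copy
of `Literature.NumberTheory.LFunctions.LSeries_term_add_mul_I` from `BohrAlmostPeriodicProofs.lean`,
not imported to keep this file light). [folklore] -/
private theorem term_ofReal_add_mul_I (b : ℕ → ℂ) (σ t : ℝ) (n : ℕ) :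
    LSeries.term b (σ + t * I) n = LSeries.term b σ n * (n : ℂ) ^ (-(t * I)) := by
  rcases eq_or_ne n 0 with rfl | hn
  · simp
  have hn' : (n : ℂ) ≠ 0 := by exact_mod_cast hn
  have h1 : (n : ℂ) ^ ((t : ℂ) * I) ≠ 0 := Complex.cpow_ne_zero_iff.2 (Or.inl hn')
  have h2 : (n : ℂ) ^ (σ : ℂ) ≠ 0 := Complex.cpow_ne_zero_iff.2 (Or.inl hn')
  rw [LSeries.term_of_ne_zero hn, LSeries.term_of_ne_zero hn, Complex.cpow_add _ _ hn',
    Complex.cpow_neg]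
  field_simp

/-- `‖n^{−it}‖ = 1` for `n ≥ 1` (private copy of the tree's `norm_natCast_cpow_neg_mul_I`).
[folklore] -/
private theorem norm_natCast_cpow_neg_ofReal_mul_I {n : ℕ} (hn : n ≠ 0) (t : ℝ) :
    ‖(n : ℂ) ^ (-(t * I))‖ = 1 := by
  rw [Complex.norm_natCast_cpow_of_pos (Nat.pos_of_ne_zero hn)]
  simp

/-- `n^{−it} = exp((−i log n) t)` for `n ≥ 1`. [folklore] -/
theorem natCast_cpow_neg_mul_I_eq_exp {n : ℕ} (hn : n ≠ 0) (t : ℝ) :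
    (n : ℂ) ^ (-(t * I)) = Complex.exp ((-(Real.log n) * I) * t) := by
  have hn' : (n : ℂ) ≠ 0 := by exact_mod_cast hn
  rw [Complex.cpow_def_of_ne_zero hn', ← Complex.natCast_log]
  congr 1; ring

/-- `∫_{T₀}^{T₀+T} n^{−it} dt` has norm `≤ 2/log n ≤ 4` for `n ≥ 2`. [folklore] -/
theorem norm_integral_natCast_cpow_le {n : ℕ} (hn : 2 ≤ n) (T₀ T : ℝ) :
    ‖∫ t in T₀..(T₀ + T), (n : ℂ) ^ (-(t * I))‖ ≤ 4 := by
  have hn0 : n ≠ 0 := by omega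
  have hlog : Real.log 2 ≤ Real.log n :=
    Real.log_le_log (by norm_num) (by exact_mod_cast hn)
  have hlog2 : (1 / 2 : ℝ) < Real.log 2 := by
    have := Real.log_two_gt_d9; linarith
  have hlogpos : 0 < Real.log n := by linarith
  set r : ℝ := Real.log n with hr
  set c : ℂ := -(r : ℂ) * I with hc
  have hc0 : c ≠ 0 :=
    mul_ne_zero (neg_ne_zero.2 (Complex.ofReal_ne_zero.2 hlogpos.ne')) Complex.I_ne_zero
  have hnc : ‖c‖ = r := by
    rw [hc, norm_mul, norm_neg, Complex.norm_I, mul_one, Complex.norm_real, Real.norm_eq_abs,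
      abs_of_pos hlogpos]
  simp_rw [natCast_cpow_neg_mul_I_eq_exp hn0]
  rw [← hr, integral_exp_mul_complex hc0, norm_div, hnc, div_le_iff₀ hlogpos]
  have h1 : ∀ x : ℝ, ‖Complex.exp (c * x)‖ = 1 := fun x ↦ by
    rw [Complex.norm_exp, hc]
    simp [Complex.mul_re]
  calc ‖Complex.exp (c * ↑(T₀ + T)) - Complex.exp (c * ↑T₀)‖
      ≤ ‖Complex.exp (c * ↑(T₀ + T))‖ + ‖Complex.exp (c * ↑T₀)‖ := norm_sub_le _ _
    _ = 2 := by rw [h1, h1]; norm_num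
    _ ≤ 4 * Real.log n := by linarith

/-- **Mean value over a long interval.** If `∑ b(n) n^{−s}` is summable at `re s = σ`, then for
`T > 0` and every `T₀`,
`‖∫_{T₀}^{T₀+T} L(σ+it) dt − T · b(1)‖ ≤ 4 ∑_n ‖term b σ n‖`
(integrate termwise: the term `n = 1` gives `T b(1)`, every other term at most
`4 ‖b(n)‖ n^{−σ}`). [folklore] -/
theorem norm_integral_LSeries_sub_le (b : ℕ → ℂ) {σ : ℝ} (hsum : LSeriesSummable b σ)
    (T₀ : ℝ) {T : ℝ} (hT : 0 ≤ T) :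
    ‖(∫ t in T₀..(T₀ + T), LSeries b (σ + t * I)) - T * b 1‖ ≤
      4 * ∑' n : ℕ, ‖LSeries.term b σ n‖ := by
  have hnorm : Summable fun n ↦ ‖LSeries.term b σ n‖ := summable_norm_iff.2 hsum
  set μ : Measure ℝ := volume.restrict (Ioc T₀ (T₀ + T)) with hμ
  haveI : IsFiniteMeasure μ := by rw [hμ]; infer_instance
  set G : ℕ → ℝ → ℂ := fun n t ↦ LSeries.term b (σ + t * I) n with hG
  have hGn : ∀ n t, ‖G n t‖ = ‖LSeries.term b σ n‖ := by
    intro n t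
    rcases eq_or_ne n 0 with rfl | hn
    · simp [hG]
    · rw [hG]; dsimp only
      rw [term_ofReal_add_mul_I, norm_mul, norm_natCast_cpow_neg_ofReal_mul_I hn, mul_one]
  have hcont : ∀ n, Continuous (G n) := by
    intro n
    rcases eq_or_ne n 0 with rfl | hn
    · simp only [hG, LSeries.term_zero]; exact continuous_const
    · have : G n = fun t : ℝ ↦ LSeries.term b σ n * Complex.exp ((-(Real.log n) * I) * t) := by
        funext t; rw [hG]; dsimp only
        rw [term_ofReal_add_mul_I, natCast_cpow_neg_mul_I_eq_exp hn]
      rw [this]; fun_prop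
  have hint : ∀ n, Integrable (G n) μ := fun n ↦
    (integrable_const (‖LSeries.term b σ n‖ : ℝ)).mono' (hcont n).aestronglyMeasurable
      (Eventually.of_forall fun t ↦ (hGn n t).le)
  have hvol : (μ Set.univ).toReal = T := by
    rw [hμ, Measure.restrict_apply_univ, Real.volume_Ioc]; simp [hT]
  have hintnorm : ∀ n, ∫ t, ‖G n t‖ ∂μ = T * ‖LSeries.term b σ n‖ := by
    intro n
    simp_rw [hGn n]
    rw [MeasureTheory.integral_const, smul_eq_mul, Measure.real, hvol]
  have hsummable : Summable fun n ↦ ∫ t, ‖G n t‖ ∂μ := by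
    simp_rw [hintnorm]; exact hnorm.mul_left T
  -- termwise integration
  have hswap : (∫ t in T₀..(T₀ + T), LSeries b (σ + t * I)) = ∑' n, ∫ t, G n t ∂μ := by
    rw [intervalIntegral.integral_of_le (by linarith), ← hμ,
      integral_tsum_of_summable_integral_norm hint hsummable]
    rfl
  -- the term `n = 1`
  have h1 : ∫ t, G 1 t ∂μ = T * b 1 := by
    have : G 1 = fun _ ↦ b 1 := by
      funext t; simp [hG]
    rw [this, MeasureTheory.integral_const, Complex.real_smul, Measure.real, hvol]
  -- the other terms
  have hother : ∀ n, n ≠ 1 → ‖∫ t, G n t ∂μ‖ ≤ 4 * ‖LSeries.term b σ n‖ := by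
    intro n hn1
    rcases eq_or_ne n 0 with rfl | hn0
    · simp [hG]
    have hn2 : 2 ≤ n := by omega
    have e : ∫ t, G n t ∂μ = LSeries.term b σ n * ∫ t in T₀..(T₀ + T), (n : ℂ) ^ (-(t * I)) := by
      rw [intervalIntegral.integral_of_le (by linarith), ← hμ, ← MeasureTheory.integral_const_mul]
      refine integral_congr_ae (Eventually.of_forall fun t ↦ ?_)
      simp only [hG, term_ofReal_add_mul_I]
    rw [e, norm_mul, mul_comm]
    exact mul_le_mul_of_nonneg_right (norm_integral_natCast_cpow_le hn2 T₀ T) (norm_nonneg _)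
  -- assemble
  have hsum' : Summable fun n ↦ ∫ t, G n t ∂μ :=
    .of_norm_bounded hsummable fun n ↦ norm_integral_le_integral_norm _
  have hδ : Summable fun n : ℕ ↦ (if n = 1 then (T : ℂ) * b 1 else 0) :=
    summable_of_ne_finset_zero (s := {1}) (by
      intro n hn; simp only [Finset.mem_singleton] at hn; simp [hn])
  have hδsum : ∑' n : ℕ, (if n = 1 then (T : ℂ) * b 1 else 0) = (T : ℂ) * b 1 := by
    rw [tsum_eq_single 1 (fun n hn ↦ if_neg hn)]; simp
  rw [hswap, ← hδsum, ← hsum'.tsum_sub hδ]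
  have hbound : ∀ n, ‖(∫ t, G n t ∂μ) - (if n = 1 then (T : ℂ) * b 1 else 0)‖ ≤
      4 * ‖LSeries.term b σ n‖ := by
    intro n
    split_ifs with h
    · subst h; rw [h1, sub_self, norm_zero]; positivity
    · rw [sub_zero]; exact hother n h
  calc ‖∑' n, ((∫ t, G n t ∂μ) - if n = 1 then (T : ℂ) * b 1 else 0)‖
      ≤ ∑' n, ‖(∫ t, G n t ∂μ) - if n = 1 then (T : ℂ) * b 1 else 0‖ := by
        refine norm_tsum_le_tsum_norm ?_
        exact .of_nonneg_of_le (fun n ↦ norm_nonneg _) hbound (hnorm.mul_left 4)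
    _ ≤ ∑' n, 4 * ‖LSeries.term b σ n‖ :=
        Summable.tsum_le_tsum hbound
          (.of_nonneg_of_le (fun n ↦ norm_nonneg _) hbound (hnorm.mul_left 4)) (hnorm.mul_left 4)
    _ = 4 * ∑' n, ‖LSeries.term b σ n‖ := tsum_mul_left

/-- **An absolutely convergent Dirichlet series is large somewhere on every long interval.** If
`∑ b(n) n^{−s}` is summable at `re s = σ` and `ε > 0`, there is `T > 0` such that every interval
`[T₀, T₀ + T]` contains some `t` with `‖b(1)‖ − ε ≤ ‖L(σ + it)‖` (the mean value of `L(σ+it)` over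
the interval is `b(1) + O(1/T)`). [folklore] -/
theorem exists_norm_LSeries_ge_on_long_interval (b : ℕ → ℂ) {σ : ℝ} (hsum : LSeriesSummable b σ)
    {ε : ℝ} (hε : 0 < ε) :
    ∃ T : ℝ, 0 < T ∧ ∀ T₀ : ℝ, ∃ t ∈ Icc T₀ (T₀ + T), ‖b 1‖ - ε ≤ ‖LSeries b (σ + t * I)‖ := by
  set S : ℝ := ∑' n : ℕ, ‖LSeries.term b σ n‖ with hS
  have hS0 : 0 ≤ S := tsum_nonneg fun n ↦ norm_nonneg _
  set T : ℝ := 4 * S / ε + 1 with hTdef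
  have hT0 : 0 < T := by positivity
  have hkey : 4 * S < ε * T := by
    rw [hTdef, mul_add, mul_div_cancel₀ _ hε.ne']; linarith
  refine ⟨T, hT0, fun T₀ ↦ ?_⟩
  by_contra hcon
  push Not at hcon
  -- then `‖∫‖ ≤ T (‖b 1‖ - ε)`
  have hI : ‖∫ t in T₀..(T₀ + T), LSeries b (σ + t * I)‖ ≤ (‖b 1‖ - ε) * |T₀ + T - T₀| :=
    norm_integral_le_of_norm_le_const fun t ht ↦ by
      rw [uIoc_of_le (by linarith)] at ht
      exact (hcon t ⟨ht.1.le, ht.2⟩).le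
  rw [show T₀ + T - T₀ = T by ring, abs_of_pos hT0] at hI
  have hM := norm_integral_LSeries_sub_le b hsum T₀ hT0.le
  rw [← hS] at hM
  -- `T ‖b 1‖ ≤ ‖∫‖ + 4S ≤ T(‖b 1‖ - ε) + 4S`, contradiction with `4S < εT`
  have h3 : ‖(T : ℂ) * b 1‖ ≤ ‖∫ t in T₀..(T₀ + T), LSeries b (σ + t * I)‖ + 4 * S := by
    have := norm_sub_norm_le ((T : ℂ) * b 1) (∫ t in T₀..(T₀ + T), LSeries b (σ + t * I))
    rw [norm_sub_rev] at this
    linarith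
  rw [norm_mul, Complex.norm_real, Real.norm_eq_abs, abs_of_pos hT0] at h3
  nlinarith [norm_nonneg (b 1)]

end Literature.NumberTheory.LFunctions
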